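import Summits.RiemannHypothesis.RiemannHypothesis.Theorems.LiCoefficientsLiFarZeroTail
import HarnessLib

/-!
# RiemannHypothesis / LiAsymptotic — the CUBIC far-zero tail (RH-FREE zero counting)

RH-FREE [rh-li-prover].  Support lemma of the rung L-P(P1⁺) «Li asymptotic law, quadratic range» (route dossier
`LiAsymptotic`, cell `pub/rh-li`, theory memo `theory/TARGETS.md` §11; the Assembly's birth stub
`stub_farZeroTailCube`): for `1000 ≤ T ≤ U`,

  `∑_{T < Im ρ ≤ U} m(ρ)/(Im ρ)³ ≤ log T/(4π T²)`,

the sum running over the zeros of `ζ` in the closed critical strip with ordinates in `(T, U]`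
(`SchoenfeldBound.zerosBetween`, multiplicities `riemannZetaZeroOrder`).  Nothing about the real parts of the
zeros is used; nothing here bears on the truth of RH.

Proof: the twin of `liFarZeroTail_bound` (`Theorems/LiCoefficientsLiFarZeroTail.lean`) with `f(t) = t⁻³` in place
of `t⁻⁴` — partial summation (`sum_zerosBetween_le_of_count_le`) against the explicit two-sided count
`|N(t) − (t/2π) log(t/2πe)| ≤ 0.3083 log t + 4.128` (`t ≥ 30`, Backlund–Trudgian), an explicit antiderivative
`F` of `3(N⁺(t) − N⁻(T))/t⁴`; main term `(log(T/2π) + 1/2)/(4πT²)`, the slack `(log 2π − 1/2)/(4πT²)` absorbing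
the `S(t)`-remainders `(0.6166 log T + 8.36)/T³` once `T ≥ 1000` (in fact `T ≥ 200`).
-/

noncomputable section

-- D-0017: `Summit.<S>.<S>.…` is the designed namespace of a single-problem summit.
set_option linter.dupNamespace false

open Real Set MeasureTheory intervalIntegral
open scoped Real

namespace Summit.RiemannHypothesis.RiemannHypothesis.Theorems.LiTheory

open Literature.NumberTheory.LFunctions Literature.NumberTheory.LFunctions.SchoenfeldBound FarZeroTail

namespace FarZeroTail

/-- The antiderivative `F₃(c, t)` of `3(N⁺(t) − c)/t⁴`:
`−(3/4π) log t/t² − (3/8π)/t² + (3(1 + log 2π)/4π)/t² − 0.3083 log t/t³ − (0.3083/3)/t³ − (4.128 − c)/t³`. -/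
def Fc (c t : ℝ) : ℝ :=
  -(3 / (4 * π)) * Real.log t * (t ^ 2)⁻¹ - 3 / (8 * π) * (t ^ 2)⁻¹
    + 3 * (1 + Real.log (2 * π)) / (4 * π) * (t ^ 2)⁻¹
    - 0.3083 * Real.log t * (t ^ 3)⁻¹ - 0.3083 / 3 * (t ^ 3)⁻¹ - (4.128 - c) * (t ^ 3)⁻¹

/-- `∂F₃/∂t = (N⁺(t) − c) · (3/t⁴)` for `t > 0`. -/
theorem hasDerivAt_Fc (c : ℝ) {t : ℝ} (ht : 0 < t) :
    HasDerivAt (Fc c) ((nUp4 t - c) * -(-3 / t ^ 4)) t := by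
  have ht0 : t ≠ 0 := ht.ne'
  have hπ : π ≠ 0 := Real.pi_ne_zero
  have hl : HasDerivAt Real.log t⁻¹ t := Real.hasDerivAt_log ht0
  have h2 := hasDerivAt_inv_sq ht0
  have h3 := hasDerivAt_inv_cube ht0
  have h := (((((hl.const_mul (-(3 / (4 * π)))).mul h2).sub (h2.const_mul (3 / (8 * π)))).add
    (h2.const_mul (3 * (1 + Real.log (2 * π)) / (4 * π)))).sub ((hl.const_mul 0.3083).mul h3)).sub
    (h3.const_mul (0.3083 / 3)) |>.sub (h3.const_mul (4.128 - c))
  refine h.congr_deriv ?_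
  unfold nUp4
  field_simp
  ring

/-- Boundary term plus the antiderivative at `U`:
`(N⁺(U) − c)/U³ + F₃(c, U) = −[(log U − log 2π + 1/2)/(4πU²) + (0.3083/3)/U³]`. -/
theorem boundary_add_Fc_eq (c : ℝ) {U : ℝ} (hU : 0 < U) :
    (nUp4 U - c) * (U ^ 3)⁻¹ + Fc c U =
      -((Real.log U - Real.log (2 * π) + 1 / 2) / (4 * π) * (U ^ 2)⁻¹ + 0.3083 / 3 * (U ^ 3)⁻¹) := by
  have hπ := Real.pi_pos
  unfold nUp4 Fc
  field_simp
  ring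

/-- `−F₃(N⁻(T), T) = (log T − log 2π + 1/2)/(4πT²) + (0.6166 log T + 0.3083/3 + 8.256)/T³`. -/
theorem neg_Fc_nLo4_eq {T : ℝ} (hT : 0 < T) :
    -Fc (nLo4 T) T = (Real.log T - Real.log (2 * π) + 1 / 2) / (4 * π) * (T ^ 2)⁻¹
      + (2 * 0.3083 * Real.log T + 0.3083 / 3 + 2 * 4.128) * (T ^ 3)⁻¹ := by
  have hπ := Real.pi_pos
  unfold Fc nLo4
  field_simp
  ring

end FarZeroTail

/-- **The cubic far-zero tail (RH-FREE zero counting).**  For `1000 ≤ T ≤ U`,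
`∑_{T < Im ρ ≤ U} m(ρ)/(Im ρ)³ ≤ log T/(4π T²)` — partial summation of `t⁻³` against the explicit two-sided
zero count `|N(t) − (t/2π)log(t/2πe)| ≤ 0.3083 log t + 4.128` (Backlund–Trudgian); main term
`(log(T/2π) + 1/2)/(4πT²)`, the slack `(log 2π − 1/2)/(4πT²)` absorbing the `S(t)`-terms `(0.6166 log T + 8.36)/T³`.
This is the statement `LiFarZeroTailCube` of the route dossier `LiAsymptotic` (Assembly stub A1). -/
theorem liFarZeroTailCube_bound :
    ∀ (T U : ℝ), 1000 ≤ T → T ≤ U →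
      ∑ ρ ∈ Literature.NumberTheory.LFunctions.SchoenfeldBound.zerosBetween T U,
          (Literature.NumberTheory.LFunctions.riemannZetaZeroOrder ρ : ℝ) / ρ.im ^ 3 ≤
        Real.log T / (4 * Real.pi * T ^ 2) := by
  intro T U hT hU
  have hT0 : 0 < T := by linarith
  have hU0 : 0 < U := by linarith
  have hπ := Real.pi_pos
  -- partial summation with `f = t⁻³`, `N ≤ N⁺` on `[T, U]`
  have h := sum_zerosBetween_le_of_count_le (T₁ := T) (T₂ := U) hT0.le hU
    (f := fun t ↦ (t ^ 3)⁻¹) (f' := fun t ↦ -3 / t ^ 4) (Nup := nUp4)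
    (fun t ht ↦ hasDerivAt_inv_cube (by linarith [ht.1] : t ≠ 0))
    (continuousOn_of_forall_continuousAt fun t ht ↦ by
      have h0 : t ≠ 0 := by linarith [ht.1]
      have h4 : t ^ 4 ≠ 0 := pow_ne_zero 4 h0
      fun_prop (disch := assumption))
    (fun t ht ↦ by
      have : 0 < t := by linarith [ht.1]
      exact div_nonpos_of_nonpos_of_nonneg (by norm_num) (by positivity))
    (by positivity) (fun t ht ↦ count_le_nUp4 (by linarith [ht.1])) (continuousOn_nUp4 hT0)
  -- replace `N(T)` by `N⁻(T)`
  have hN := nLo4_le_count (t := T) (by linarith)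
  have hbd : (nUp4 U - zetaZeroCount T) * (U ^ 3)⁻¹ ≤ (nUp4 U - nLo4 T) * (U ^ 3)⁻¹ :=
    mul_le_mul_of_nonneg_right (by linarith) (by positivity)
  have hcont : ∀ c' : ℝ, ContinuousOn (fun t ↦ (nUp4 t - c') * -(-3 / t ^ 4)) (Icc T U) := fun c' ↦
    continuousOn_of_forall_continuousAt fun t ht ↦ by
      have h0 : t ≠ 0 := by linarith [ht.1]
      have h4 : t ^ 4 ≠ 0 := pow_ne_zero 4 h0
      refine ((continuousAt_nUp4 h0).sub continuousAt_const).mul ?_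
      fun_prop (disch := assumption)
  have hint_le : ∫ t in T..U, (nUp4 t - zetaZeroCount T) * -(-3 / t ^ 4) ≤
      ∫ t in T..U, (nUp4 t - nLo4 T) * -(-3 / t ^ 4) := by
    refine integral_mono_on hU ((hcont _).intervalIntegrable_of_Icc hU)
      ((hcont _).intervalIntegrable_of_Icc hU) fun t ht ↦ ?_
    have : 0 < t := by linarith [ht.1]
    have : 0 ≤ -(-3 / t ^ 4) := by rw [neg_div, neg_neg]; positivity
    nlinarith
  -- evaluate the integral by the antiderivative
  have hFTC : ∫ t in T..U, (nUp4 t - nLo4 T) * -(-3 / t ^ 4) = Fc (nLo4 T) U - Fc (nLo4 T) T := by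
    refine integral_eq_sub_of_hasDerivAt (fun t ht ↦ ?_) ((hcont _).intervalIntegrable_of_Icc hU)
    rw [uIcc_of_le hU] at ht
    exact hasDerivAt_Fc _ (by linarith [ht.1])
  -- the sum rewritten with `/`
  have hsum : ∑ ρ ∈ zerosBetween T U, (riemannZetaZeroOrder ρ : ℝ) / ρ.im ^ 3 =
      ∑ ρ ∈ zerosBetween T U, (riemannZetaZeroOrder ρ : ℝ) * (ρ.im ^ 3)⁻¹ :=
    Finset.sum_congr rfl fun ρ _ ↦ div_eq_mul_inv _ _
  rw [hsum]
  have h2π : Real.log (2 * π) ≤ 2 := by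
    have hπ' := Real.pi_lt_d2
    have he := Real.exp_one_gt_d9
    rw [Real.log_le_iff_le_exp (by positivity)]
    have h2 : Real.exp 2 = Real.exp 1 * Real.exp 1 := by rw [← Real.exp_add]; norm_num
    rw [h2]
    nlinarith
  -- the `U`-remainder is non-positive
  have hrem : (nUp4 U - nLo4 T) * (U ^ 3)⁻¹ + Fc (nLo4 T) U ≤ 0 := by
    rw [boundary_add_Fc_eq _ hU0]
    have hlogU : 2 ≤ Real.log U := by
      rw [Real.le_log_iff_exp_le (by linarith)]
      have he := Real.exp_one_lt_d9
      have h2 : Real.exp 2 = Real.exp 1 * Real.exp 1 := by rw [← Real.exp_add]; norm_num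
      rw [h2]
      nlinarith [Real.exp_pos (1 : ℝ)]
    have : 0 ≤ (Real.log U - Real.log (2 * π) + 1 / 2) / (4 * π) * (U ^ 2)⁻¹ := by
      have : 0 ≤ Real.log U - Real.log (2 * π) + 1 / 2 := by linarith
      positivity
    have : (0 : ℝ) ≤ 0.3083 / 3 * (U ^ 3)⁻¹ := by positivity
    linarith
  -- the value at `T`
  have hmain : -Fc (nLo4 T) T ≤ Real.log T / (4 * π * T ^ 2) := by
    rw [neg_Fc_nLo4_eq hT0]
    have h2π' := log_two_pi_ge
    have hlogT : Real.log T ≤ 6 + T / 1000 := by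
      have h1 : Real.log T ≤ Real.log 1000 + (T / 1000 - 1) := by
        have := Real.log_le_sub_one_of_pos (show 0 < T / 1000 by positivity)
        have hdiv : Real.log (T / 1000) = Real.log T - Real.log 1000 :=
          Real.log_div hT0.ne' (by norm_num)
        linarith
      have h7 : Real.log 1000 ≤ 7 := by
        rw [Real.log_le_iff_le_exp (by norm_num)]
        have he := Real.exp_one_gt_d9
        have h7 : Real.exp 7 = Real.exp 1 ^ 7 := by
          rw [← Real.exp_nat_mul]; norm_num
        rw [h7]
        exact le_trans (by norm_num) (pow_le_pow_left₀ (by norm_num) he.le 7)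
      linarith
    have hT2 : 0 < T ^ 2 := by positivity
    have hT3 : 0 < T ^ 3 := by positivity
    have key : (2 * 0.3083 * Real.log T + 0.3083 / 3 + 2 * 4.128) * (T ^ 3)⁻¹ ≤
        (Real.log (2 * π) - 1 / 2) / (4 * π) * (T ^ 2)⁻¹ := by
      rw [show (T ^ 3)⁻¹ = T⁻¹ * (T ^ 2)⁻¹ by rw [← mul_inv, ← pow_succ'], ← mul_assoc]
      refine mul_le_mul_of_nonneg_right ?_ (by positivity)
      rw [← div_eq_mul_inv, div_le_div_iff₀ hT0 (by positivity)]
      have hA : 2 * 0.3083 * Real.log T + 0.3083 / 3 + 2 * 4.128 ≤ 12.06 + 0.00062 * T := by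
        linarith [hlogT]
      have hA0 : 0 ≤ 2 * 0.3083 * Real.log T + 0.3083 / 3 + 2 * 4.128 := by
        have : 0 ≤ Real.log T := Real.log_nonneg (by linarith)
        positivity
      have hB : 4 * π ≤ 12.57 := by linarith [Real.pi_lt_d4]
      calc (2 * 0.3083 * Real.log T + 0.3083 / 3 + 2 * 4.128) * (4 * π)
          ≤ (12.06 + 0.00062 * T) * 12.57 := mul_le_mul hA hB (by positivity) (by positivity)
        _ ≤ (1.8 - 1 / 2) * T := by linarith
        _ ≤ (Real.log (2 * π) - 1 / 2) * T := mul_le_mul_of_nonneg_right (by linarith) hT0.le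
    have e : Real.log T / (4 * π * T ^ 2) =
        (Real.log T - Real.log (2 * π) + 1 / 2) / (4 * π) * (T ^ 2)⁻¹ +
          (Real.log (2 * π) - 1 / 2) / (4 * π) * (T ^ 2)⁻¹ := by
      field_simp
      ring
    rw [e]
    linarith
  linarith [h, hbd, hint_le, hFTC, hrem, hmain]

end Summit.RiemannHypothesis.RiemannHypothesis.Theorems.LiTheory

end
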